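import Literature.AnabelianGeometry.SemiGraphs.ProSigmaCompletionQuotients
import Mathlib.Topology.Algebra.Group.Quotient
import Mathlib.GroupTheory.Abelianization.Defs
import HarnessLib

/-!
# Pro-`Σ` completions pass to quotients and to (topological) abelianisations

[SemiAnbd] (S. Mochizuki, *Semi-graphs of anabelioids*, Publ. RIMS **42** (2006)) Example 2.10 p. 31
works with "the maximal pro-`Σ` quotient of the fundamental group of a hyperbolic Riemann surface of
finite type", typed by abc-iut-L3-t1 as `SemiGraphOfAnabelioids.IsProSigmaCompletion Sigma ι`
(`Coverticial.lean`); [CombGC] (Tohoku Math. J. **59** (2007)) Def. 1.1 (ii) / Rmk. 1.1.5 p. 8 then uses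
the ABELIANISATIONS of these groups ("`M_G := Π_G^{ab}` … a free `Ẑ^Σ`-module of rank `2 g`"), typed by
abc-iut-L3-t4 / abc-iut-w4-d052 as `PSCDatum.UnrVertAbOfRank` / `PSCDatum.IsSturdyAt` in the currency
"`∃ ι : ℤ^{2g} →* (topological abelianisation), IsProSigmaCompletion Σ ι`".
[cite: MochizukiSemiAnbd2006, Ex. 2.10 p.31] [cite: MochizukiCombGC2007, Rmk 1.1.5 p.8]

PROOF-ONLY file (abc-iut cell, layer L3 support brick «PROSIGMA-QUOTIENT-TRANSFER», seat
abc-iut-w5-d195 gen 6; the "abelianisation-of-completion transfer" named as missing by abc-iut-f-165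
2026-08-26T10:13Z for the non-vacuity of the [CombGC] origin inputs at genuine data).  Plain
(pro)finite group theory over the tree's `IsProSigmaCompletion` API (`ProSigmaCompletionQuotients.lean`):

* `normal_of_coe_eq_closure_image` — if `ι` has dense range and `N ⊴ Γ`, a subgroup `K ≤ P` whose
  underlying set is the closure of `ι(N)` is normal in `P`;
* `quotientMap_of_coe_eq_closure` — **pro-`Σ` completions pass to quotients**: for `ι : Γ → P` a
  pro-`Σ` completion, `N ⊴ Γ`, `K ⊴ P` with `K = closure ι(N)`, the induced map
  `Γ ⧸ N → P ⧸ K` is a pro-`Σ` completion;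
* `topologicalClosure_map_commutator_eq` — dense range ⇒ `closure ι([Γ,Γ]) = closure [P,P]`;
* `abelianizationMap` — **pro-`Σ` completions pass to abelianisations**: the induced map
  `Γ^{ab} = Γ ⧸ [Γ,Γ] → P ⧸ closure [P,P]` (the TOPOLOGICAL abelianisation of `P`) is a pro-`Σ`
  completion.

No definitions; nothing here takes a side on [IUTchIII] Cor. 3.12.
-/

namespace Literature.AnabelianGeometry.SemiGraphs.SemiGraphOfAnabelioids.IsProSigmaCompletion

open Literature.AnabelianGeometry.Anabelioids Topology
open scoped commutatorElement

variable {Sigma : Set ℕ} {Γ : Type*} [Group Γ] {P : Type*} [Group P] [TopologicalSpace P]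
  [IsTopologicalGroup P] {ι : Γ →* P}

/-! ### Closures of images of normal subgroups are normal -/

/-- If `ι : Γ → P` has dense range and `N ⊴ Γ`, then a subgroup `K ≤ P` with
`K = closure ι(N)` is normal: the set of `p` conjugating `K` into itself is closed and contains the
dense subset `ι(Γ)`. [cite: MochizukiSemiAnbd2006, Ex. 2.10 p.31] -/
theorem normal_of_coe_eq_closure_image (hd : DenseRange ι) (N : Subgroup Γ) [N.Normal]
    (K : Subgroup P) (hK : (K : Set P) = closure (ι '' (N : Set Γ))) : K.Normal := by
  -- the conjugation-stable set
  let S : Set P := {p | ∀ k ∈ K, p * k * p⁻¹ ∈ K}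
  have hS : IsClosed S := by
    have : S = ⋂ k ∈ K, (fun p : P => p * k * p⁻¹) ⁻¹' (K : Set P) := by
      ext p; simp only [S, Set.mem_setOf_eq, Set.mem_iInter, Set.mem_preimage, SetLike.mem_coe]
    rw [this]
    refine isClosed_biInter fun k _ => ?_
    have hKc : IsClosed (K : Set P) := by rw [hK]; exact isClosed_closure
    exact hKc.preimage ((continuous_id.mul continuous_const).mul continuous_id.inv)
  have hι : ∀ γ : Γ, ι γ ∈ S := by
    intro γ k hk
    -- conjugation by `ι γ` is continuous and maps `ι(N)` into itself
    have hcont : Continuous fun x : P => ι γ * x * (ι γ)⁻¹ :=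
      (continuous_const.mul continuous_id).mul continuous_const
    have himg : (fun x : P => ι γ * x * (ι γ)⁻¹) '' (ι '' (N : Set Γ)) ⊆ ι '' (N : Set Γ) := by
      rintro _ ⟨_, ⟨n, hn, rfl⟩, rfl⟩
      refine ⟨γ * n * γ⁻¹, ‹N.Normal›.conj_mem n hn γ, ?_⟩
      simp only [map_mul, map_inv]
    have hk' : k ∈ closure (ι '' (N : Set Γ)) := by rw [← hK]; exact hk
    have := image_closure_subset_closure_image hcont ⟨k, hk', rfl⟩
    rw [← SetLike.mem_coe, hK]
    exact closure_mono himg this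
  have hSu : S = Set.univ := by
    refine Set.eq_univ_of_univ_subset ?_
    have h1 : Set.range ι ⊆ S := by rintro _ ⟨γ, rfl⟩; exact hι γ
    calc Set.univ ⊆ closure (Set.range ι) := by rw [hd.closure_range]
      _ ⊆ S := closure_minimal h1 hS
  refine ⟨fun k hk p => ?_⟩
  have hp : p ∈ S := by rw [hSu]; exact Set.mem_univ p
  exact hp k hk

/-- In particular the topological closure of `ι(N)` is normal for `N ⊴ Γ`.
[cite: MochizukiSemiAnbd2006, Ex. 2.10 p.31] -/
theorem normal_topologicalClosure_map (hd : DenseRange ι) (N : Subgroup Γ) [N.Normal] :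
    ((N.map ι).topologicalClosure).Normal :=
  normal_of_coe_eq_closure_image hd N _ (by rw [Subgroup.topologicalClosure_coe, Subgroup.coe_map])

/-! ### Pro-`Σ` completions pass to quotients -/

omit [TopologicalSpace P] [IsTopologicalGroup P] in
/-- `N ≤ ι⁻¹(K)` as soon as `ι(N) ⊆ K`. [cite: MochizukiSemiAnbd2006, Ex. 2.10 p.31] -/
theorem le_comap_of_image_subset {N : Subgroup Γ} {K : Subgroup P}
    (h : ι '' (N : Set Γ) ⊆ (K : Set P)) : N ≤ K.comap ι :=
  fun n hn => h ⟨n, hn, rfl⟩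

omit [IsTopologicalGroup P] in
/-- `ι(N) ⊆ K` when `K = closure ι(N)`. [cite: MochizukiSemiAnbd2006, Ex. 2.10 p.31] -/
theorem image_subset_of_coe_eq_closure {N : Subgroup Γ} {K : Subgroup P}
    (hK : (K : Set P) = closure (ι '' (N : Set Γ))) : ι '' (N : Set Γ) ⊆ (K : Set P) := by
  rw [hK]; exact subset_closure

/-- **Pro-`Σ` completions pass to quotients.**  Let `ι : Γ → P` be a pro-`Σ` completion, `N ⊴ Γ`,
and `K ⊴ P` a normal subgroup whose underlying set is the closure of `ι(N)`.  Then the induced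
homomorphism `Γ ⧸ N → P ⧸ K` is a pro-`Σ` completion: its range is dense (image of a dense range under
the continuous surjection `P → P ⧸ K`); open normal subgroups of `P ⧸ K` pull back to open normal
subgroups of `P` of the same index; and a normal `Σ`-index `L ≤ Γ ⧸ N` pulls back to a normal
`Σ`-index `L' ≥ N` of `Γ`, which is `ι⁻¹(U)` for an open `U ⊇ ι(N)`, hence `U ⊇ K` (open subgroups
are closed), so that `L` is the pull-back of the open subgroup `U ⧸ K`.
[cite: MochizukiSemiAnbd2006, Ex. 2.10 p.31] -/
theorem quotientMap_of_coe_eq_closure (hι : IsProSigmaCompletion Sigma ι) (N : Subgroup Γ) [N.Normal]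
    (K : Subgroup P) [K.Normal] (hK : (K : Set P) = closure (ι '' (N : Set Γ))) :
    IsProSigmaCompletion Sigma
      (QuotientGroup.map N K ι (le_comap_of_image_subset (image_subset_of_coe_eq_closure hK))) := by
  set φ := QuotientGroup.map N K ι (le_comap_of_image_subset (image_subset_of_coe_eq_closure hK))
    with hφ
  have hφmk : ∀ γ : Γ, φ (QuotientGroup.mk γ) = QuotientGroup.mk (ι γ) := fun γ => rfl
  refine ⟨?_, ?_, ?_⟩
  · -- dense range
    have hrange : Set.range φ = Set.range (fun γ : Γ => (QuotientGroup.mk (ι γ) : P ⧸ K)) := by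
      ext q
      constructor
      · rintro ⟨x, rfl⟩
        obtain ⟨γ, rfl⟩ := QuotientGroup.mk_surjective x
        exact ⟨γ, (hφmk γ).symm⟩
      · rintro ⟨γ, rfl⟩
        exact ⟨QuotientGroup.mk γ, hφmk γ⟩
    change DenseRange φ
    rw [DenseRange, hrange]
    exact (QuotientGroup.mk_surjective (s := K)).denseRange.comp hι.dense
      QuotientGroup.continuous_mk
  · -- open normal subgroups have `Σ`-integer index
    intro M hMn hMo
    have hM'o : IsOpen ((M.comap (QuotientGroup.mk' K) : Subgroup P) : Set P) :=
      hMo.preimage QuotientGroup.continuous_mk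
    haveI : (M.comap (QuotientGroup.mk' K)).Normal := inferInstance
    have h := hι.index_open (M.comap (QuotientGroup.mk' K)) inferInstance hM'o
    rwa [Subgroup.index_comap_of_surjective M (QuotientGroup.mk'_surjective K)] at h
  · -- universality
    intro L hLn hL
    haveI := hLn
    set L' : Subgroup Γ := L.comap (QuotientGroup.mk' N) with hL'
    haveI : L'.Normal := inferInstance
    have hL'i : IsSigmaInteger Sigma L'.index := by
      rwa [hL', Subgroup.index_comap_of_surjective L (QuotientGroup.mk'_surjective N)]
    obtain ⟨U, hUo, hUL⟩ := hι.comap_surj L' inferInstance hL'i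
    -- `K ≤ U`
    have hNU : ι '' (N : Set Γ) ⊆ (U : Set P) := by
      rintro _ ⟨n, hn, rfl⟩
      have : n ∈ L' := by
        rw [hL', Subgroup.mem_comap, QuotientGroup.mk'_apply, (QuotientGroup.eq_one_iff n).mpr hn]
        exact L.one_mem
      rw [← hUL] at this
      exact this
    have hKU : K ≤ U := by
      intro k hk
      have hk' : k ∈ closure (ι '' (N : Set Γ)) := by rw [← hK]; exact hk
      exact closure_minimal hNU (U.isClosed_of_isOpen hUo) hk'
    refine ⟨U.map (QuotientGroup.mk' K), ?_, ?_⟩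
    · exact QuotientGroup.isOpenMap_coe _ hUo
    · ext x
      obtain ⟨γ, rfl⟩ := QuotientGroup.mk_surjective x
      rw [Subgroup.mem_comap, hφmk]
      constructor
      · rintro ⟨u, hu, hue⟩
        -- `mk u = mk (ι γ)` ⇒ `ι γ ∈ u K ⊆ U`
        have hmem : ι γ ∈ U := by
          rw [QuotientGroup.mk'_apply, QuotientGroup.eq] at hue
          have : u⁻¹ * ι γ ∈ U := hKU hue
          simpa using U.mul_mem hu this
        have : γ ∈ L' := by rw [← hUL]; exact hmem
        rw [hL', Subgroup.mem_comap] at this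
        exact this
      · intro hγ
        have : γ ∈ L' := by rw [hL', Subgroup.mem_comap]; exact hγ
        rw [← hUL, Subgroup.mem_comap] at this
        exact ⟨ι γ, this, rfl⟩

/-- **Pro-`Σ` completions pass to quotients** (closure form): for `N ⊴ Γ` the induced map
`Γ ⧸ N → P ⧸ closure ι(N)` is a pro-`Σ` completion. [cite: MochizukiSemiAnbd2006, Ex. 2.10 p.31] -/
theorem quotientMap (hι : IsProSigmaCompletion Sigma ι) (N : Subgroup Γ) [N.Normal]
    [hKn : ((N.map ι).topologicalClosure).Normal] :
    IsProSigmaCompletion Sigma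
      (QuotientGroup.map N (N.map ι).topologicalClosure ι
        (le_comap_of_image_subset (image_subset_of_coe_eq_closure
          (by rw [Subgroup.topologicalClosure_coe, Subgroup.coe_map])))) :=
  quotientMap_of_coe_eq_closure hι N _ (by rw [Subgroup.topologicalClosure_coe, Subgroup.coe_map])

/-! ### Commutators: `closure ι([Γ,Γ]) = closure [P,P]` -/

omit [TopologicalSpace P] [IsTopologicalGroup P] in
/-- `ι([Γ,Γ]) ≤ [P,P]`. [cite: MochizukiCombGC2007, Rmk 1.1.5 p.8] -/
theorem map_commutator_le (ι : Γ →* P) : (commutator Γ).map ι ≤ commutator P := by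
  rw [commutator_def, commutator_def, Subgroup.map_commutator]
  exact Subgroup.commutator_mono le_top le_top

/-- **Dense range ⇒ `closure ι([Γ,Γ]) = closure [P,P]`**: every commutator `⁅p, q⁆` of `P` lies in
the closed subgroup `closure ι([Γ,Γ])`, the set of pairs `(p, q)` with this property being closed in
`P × P` and containing the dense subset `ι(Γ) × ι(Γ)`. [cite: MochizukiCombGC2007, Rmk 1.1.5 p.8] -/
theorem topologicalClosure_map_commutator_eq (hd : DenseRange ι) :
    ((commutator Γ).map ι).topologicalClosure = (commutator P).topologicalClosure := by
  apply le_antisymm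
  · exact Subgroup.topologicalClosure_mono (map_commutator_le ι)
  · refine Subgroup.topologicalClosure_minimal _ ?_ (Subgroup.isClosed_topologicalClosure _)
    set C := ((commutator Γ).map ι).topologicalClosure with hC
    have hCc : IsClosed (C : Set P) := Subgroup.isClosed_topologicalClosure _
    rw [commutator_def, Subgroup.commutator_le]
    intro p _ q _
    -- the closed set of pairs whose commutator lies in `C`
    let T : Set (P × P) := {x | ⁅x.1, x.2⁆ ∈ C}
    have hT : IsClosed T := by
      have : T = (fun x : P × P => x.1 * x.2 * x.1⁻¹ * x.2⁻¹) ⁻¹' (C : Set P) := by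
        ext x; simp only [T, Set.mem_setOf_eq, Set.mem_preimage, SetLike.mem_coe, commutatorElement_def]
      rw [this]
      exact hCc.preimage (by fun_prop)
    have hsub : Set.range (Prod.map ι ι) ⊆ T := by
      rintro _ ⟨⟨γ, δ⟩, rfl⟩
      change ⁅ι γ, ι δ⁆ ∈ C
      rw [← map_commutatorElement]
      exact Subgroup.le_topologicalClosure _
        (Subgroup.mem_map_of_mem ι (Subgroup.commutator_mem_commutator (Subgroup.mem_top γ)
          (Subgroup.mem_top δ)))
    have hdense : DenseRange (Prod.map ι ι) := hd.prodMap hd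
    have hTu : T = Set.univ := by
      refine Set.eq_univ_of_univ_subset ?_
      calc Set.univ ⊆ closure (Set.range (Prod.map ι ι)) := by rw [hdense.closure_range]
        _ ⊆ T := closure_minimal hsub hT
    have hpq : (p, q) ∈ T := by rw [hTu]; exact Set.mem_univ _
    simpa only [T, Set.mem_setOf_eq] using hpq

/-- The closure of the commutator subgroup of `P` is normal. [cite: MochizukiCombGC2007, Rmk 1.1.5 p.8] -/
theorem normal_topologicalClosure_commutator :
    ((commutator P).topologicalClosure).Normal :=
  Subgroup.is_normal_topologicalClosure _

/-! ### Pro-`Σ` completions pass to abelianisations -/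

/-- `[Γ,Γ] ≤ ι⁻¹(closure [P,P])`. [cite: MochizukiCombGC2007, Rmk 1.1.5 p.8] -/
theorem commutator_le_comap_topologicalClosure_commutator (ι : Γ →* P) :
    commutator Γ ≤ ((commutator P).topologicalClosure).comap ι :=
  Subgroup.map_le_iff_le_comap.mp ((map_commutator_le ι).trans (Subgroup.le_topologicalClosure _))

/-- **Pro-`Σ` completions pass to (topological) abelianisations.**  For `ι : Γ → P` a pro-`Σ`
completion, the induced homomorphism from `Γ^{ab} = Γ ⧸ [Γ,Γ]` to the topological abelianisation
`P ⧸ closure [P,P]` is a pro-`Σ` completion.  At a genuine [CombGC] datum (`P` the pro-`Σ`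
completion of a surface group `S_g`, so `Γ^{ab} ≅ ℤ^{2g}`) this is the currency of Rmk. 1.1.5
"`M_G` is a free `Ẑ^Σ`-module of rank `2g`" (`PSCDatum.UnrVertAbOfRank`).
[cite: MochizukiCombGC2007, Rmk 1.1.5 p.8] -/
theorem abelianizationMap (hι : IsProSigmaCompletion Sigma ι)
    [hKn : ((commutator P).topologicalClosure).Normal] :
    IsProSigmaCompletion Sigma
      (QuotientGroup.map (commutator Γ) (commutator P).topologicalClosure ι
        (commutator_le_comap_topologicalClosure_commutator ι)) := by
  have hK : (((commutator P).topologicalClosure : Subgroup P) : Set P) =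
      closure (ι '' ((commutator Γ : Subgroup Γ) : Set Γ)) := by
    rw [← topologicalClosure_map_commutator_eq hι.dense, Subgroup.topologicalClosure_coe,
      Subgroup.coe_map]
  exact quotientMap_of_coe_eq_closure hι (commutator Γ) _ hK

end Literature.AnabelianGeometry.SemiGraphs.SemiGraphOfAnabelioids.IsProSigmaCompletion
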